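import Summits.BirchSwinnertonDyer.BirchSwinnertonDyer.Theorems.AdditiveKolyvaginRoadManinFrameResidueProperRTameTwistFull57UnitTwist
import Summits.BirchSwinnertonDyer.BirchSwinnertonDyer.Theorems.AdditiveKolyvaginRoadManinFrameResidueProperRTorsTwist
import HarnessLib

/-!
# Route `AdditiveKolyvaginRoad`, crux `ManinFrameResidueProperR` (stmt-BirchSwinnertonDyer-20709), line
# `tame_twist`: the registered stub `stub_memberManinUnit_fiveSeven_torsion` GRANTED F″ and L-TWIST only
# (TORS-TWIST discharged) — `--supports`, helper

Cell `pub/bsd-wall`, seat `bsd-wall-manin-p1` (g6). THEOREMS ONLY; route-free (binder list spelled out, no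
`Theses` import). Nothing is closed; BSD is not proved by this file.

`ManinFrameResidueProperRTameTwistUnitTwist.stub_memberManinUnit_fiveSeven_torsion_of_twistInputs` (seat
`bsd-line-edix-p2`, p585934) derived the registered Kosters–Pannekoek stub of crux 20709 from F″ (`hK`, the line's
other stub `stub_katoNeronFiveLe`) and two inputs, L-TWIST (`hLT`, twisted-period decomposition ⟸ Ihara's lemma)
and TORS-TWIST (`hTT`). TORS-TWIST is now the unconditional theorem `TorsTwist.torsTwist`
(`AdditiveKolyvaginRoadManinFrameResidueProperRTorsTwist.lean`), so the stub follows from F″ and L-TWIST alone: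
`stub_memberManinUnit_fiveSeven_torsion_of_kato_of_lTwist`. Remaining inputs of line `tame_twist` after this
file: F″ (`kato_neron_isIntegral_twistedSymbolSum_of_additive_five_le`, published, statement-only) and L-TWIST
(⟸ `ModularForms.ribet1984_iharaLemma`, cite-only).

References: [Stevens1989] Lemma (5.2); [Ribet1984ICM] Thm. 4.1; [Kato2004Asterisque] (8.1.3), Thm. 9.7;
[SilvermanAEC2009] III.8.1, X.5 Cor. 5.4.
-/

set_option autoImplicit false
-- the Theorems directory repeats the summit name (sibling precedent `SignedBaseChangeAssembly.lean`)
set_option linter.dupNamespace false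

noncomputable section

open scoped Classical MatrixGroups

open WeierstrassCurve NumberField Literature.NumberTheory.EllipticCurves
  Literature.NumberTheory.EllipticCurves.ModularForms
  Literature.NumberTheory.EllipticCurves.Rank1Residual
  Literature.NumberTheory.DiophantineGeometry IsDedekindDomain Rat.HeightOneSpectrum
  Summit.BirchSwinnertonDyer.Rank1Residual Summit.BirchSwinnertonDyer.Rank1Residual.Additive
  Summit.BirchSwinnertonDyer.BirchSwinnertonDyer.Theorems CongruenceSubgroup

namespace Summit.BirchSwinnertonDyer.BirchSwinnertonDyer.Theorems.ManinFrameResidueProperRTameTwistLTwist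

/-- **The registered stub `stub_memberManinUnit_fiveSeven_torsion` of crux 20709 (binder list VERBATIM), GRANTED
F″ (`hK`) and L-TWIST (`hLT`) only**: `stub_memberManinUnit_fiveSeven_torsion_of_twistInputs` with its TORS-TWIST
hypothesis discharged by the theorem `TorsTwist.torsTwist`. CONDITIONAL on F″ (cite-only) and L-TWIST (not in
the tree; ⟸ Ihara's lemma); nothing closed; BSD is not proved by this.
[cite: Stevens1989, Lemma (5.2) p. 96] [cite: Kato2004Asterisque, Thm. 9.7 (p. 189)]
[cite: SilvermanAEC2009, III.8.1, X.5 Cor. 5.4] -/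
theorem stub_memberManinUnit_fiveSeven_torsion_of_kato_of_lTwist
    (hK : kato_neron_isIntegral_twistedSymbolSum_of_additive_five_le)
    (hLT : ∀ (p : ℕ) [Fact p.Prime] (q : ℕ) [Fact q.Prime] (V₀ : WeierstrassCurve ℚ) [V₀.IsElliptic]
      [V₀.IsGloballyMinimal] [NeZero (V₀.conductorNorm ℤ)]
      (D₀ : ModularParametrizationData V₀ (V₀.conductorNorm ℤ)), 5 ≤ p → Irr V₀ p → q ≠ 2 → q ≠ p →
      ¬ q ∣ V₀.conductorNorm ℤ →
      ∀ (Vχ : WeierstrassCurve ℚ) [Vχ.IsElliptic] [Vχ.IsGloballyMinimal] (v : VariableChange ℚ),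
      v • V₀.quadraticTwist (((-1 : ℤ) ^ (q / 2) * q : ℤ) : ℚ) = Vχ →
      ∀ (s : ℂ), s ^ 2 = (((-1 : ℤ) ^ (q / 2) * q : ℤ) : ℂ) →
      ∀ (N' : ℕ) [NeZero N'] (g : CuspForm (Gamma0 N') 2), IsNewformOf Vχ g →
      ∀ z ∈ periodLattice D₀.f, ∃ w ∈ periodLattice g, ∃ y ∈ periodLattice D₀.f, z = s * w + (p : ℂ) * y)
    (dd : dokchitser_padicValInt_minimalDiscriminantInt_eq_of_isogeny_of_not_dvd_degree)
    (hnf : exists_isNewformOf)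
    (W : WeierstrassCurve ℚ) [W.IsElliptic] [W.IsGloballyMinimal] (p : ℕ) [Fact p.Prime]
    [NeZero (W.conductorNorm ℤ)] (hp5 : 5 ≤ p) (hp11 : p < 11) (hadd : Addv W p) (hirr : Irr W p)
    (hres : ((p < 11 ∨ ∃ (W' : WeierstrassCurve ℚ) (_ : W'.IsElliptic) (_ : W'.IsGloballyMinimal),
          IsIsogenous W W' ∧ TypeGOrd W' p ∧ padicValInt p W'.minimalDiscriminantInt ≤ 4) ∧
        (∃ (W' : WeierstrassCurve ℚ) (_ : W'.IsElliptic) (_ : W'.IsGloballyMinimal),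
          IsIsogenous W W' ∧ ∀ (v : HeightOneSpectrum ℤ) (n : ℕ), natGenerator v = p →
            W'.kodairaSymbolAt v ≠ KodairaSymbol.Istar n)))
    (hall : (∀ (W' : WeierstrassCurve ℚ) [W'.IsElliptic] [W'.IsGloballyMinimal]
          (D' : ModularParametrizationData W' (W.conductorNorm ℤ)),
          IsIsogenous W W' → p ∣ D'.modularDegree))
    (hT : ∃ (W' : WeierstrassCurve ℚ) (_ : W'.IsElliptic) (_ : W'.IsGloballyMinimal),
      IsIsogenous W W' ∧ ∃ P : (W'.baseChange ℚ_[p]).toAffine.Point, p • P = 0 ∧ P ≠ 0) :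
    ∃ (W₀ : WeierstrassCurve ℚ) (_ : W₀.IsElliptic) (_ : W₀.IsGloballyMinimal)
        (D₀ : ModularParametrizationData W₀ (W.conductorNorm ℤ)),
        IsIsogenous W W₀ ∧ ¬ (p : ℤ) ∣ D₀.c :=
  ManinFrameResidueProperRTameTwistUnitTwist.stub_memberManinUnit_fiveSeven_torsion_of_twistInputs hK hLT
    TorsTwist.torsTwist dd hnf W p hp5 hp11 hadd hirr hres hall hT

end Summit.BirchSwinnertonDyer.BirchSwinnertonDyer.Theorems.ManinFrameResidueProperRTameTwistLTwist

end
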